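import Summits.Ventures.Crystal3D.Theorems.StickyWulffConstantGenericWallFloorSlotCovering
import Summits.Ventures.Crystal3D.Theorems.StickyWulffConstantGenericWallFloorHRowWalk
import HarnessLib

/-!
# The √2-GAP around a completely kissed ball: every other ball is a member of the dozen (distance 1) or at distance ≥ √2
# (crux `GenericWallFloor`, stmt-Ventures-19480, kernel G; second brick of TRACK 2′ = the structural proof of `HRowEndFarApart`; 19480-p2 g14)

HONEST FRAMING. Venture `Summits/Ventures/Crystal3D` (cell `crystal3d-full`), route `route-Ventures-StickyWulffConstant`, helper for the crux
`GenericWallFloor` (stmt-Ventures-19480) / consumer `TextureLiminfV5` (stmt-Ventures-23912).  Elementary packing geometry from the 45° covering of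
`…SlotCovering`; standard axioms; F-C1 not moved.

THE POINT.  If a ball `c` of a `1`-separated `X` carries a complete close-packed dozen — FULL (`c + F'·fccSlots ⊆ X`), or TWIN across a unit menu normal
`n₀` (`c + F' w ∈ X` for `⟪F' w, n₀⟫ ≥ 0` and `c + F' w − 2√(2/3)·n₀ ∈ X` for `⟪F' w, n₀⟫ > 0`, the shape of `CapCertified` and of the h-dozen
`hcpSlots`) — then every `x ∈ X` with `x ≠ c` and `dist x c < √2` IS one of the twelve: the direction of `x − c` is within 45° of a dozen vector `m`
(on the correct side of the twin plane, reflecting across it if necessary), and then `dist x (c + m) < 1`, so `x = c + m` by separation.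
* `dist_lt_one_of_inner_ge` — the distance estimate `‖v − m‖ < 1` for `√2/2·‖v‖ ≤ ⟪v, m⟫`, `0 < ‖v‖ < √2`, `‖m‖ = 1`;
* **`mem_fullDozen_of_dist_lt_sqrt_two`**, **`mem_capDozen_of_dist_lt_sqrt_two`**, **`mem_hcpDozen_of_dist_lt_sqrt_two`** — the three forms;
* `dist_eq_one_or_sqrt_two_le_of_hcpDozen` — the dichotomy form for the h-dozen.
WHAT THIS IS NOT: nothing about walkers or rows; F-C1 not moved.
-/

noncomputable section

namespace Summit.Ventures.Crystal3D.Theorems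

open Finset
open Literature.MathematicalPhysics.StatisticalMechanics (basalMirror basalMirror_apply_coord)
open scoped InnerProductSpace

variable {X : Finset (EuclideanSpace ℝ (Fin 3))}

/-! ### The distance estimate -/

/-- **`‖v − m‖ < 1`** when `‖m‖ = 1`, `0 < ‖v‖ < √2` and `⟪v, m⟫ ≥ (√2/2)‖v‖` (`‖v − m‖² = ‖v‖² + 1 − 2⟪v,m⟫ ≤ ‖v‖(‖v‖ − √2) + 1 < 1`). -/
theorem norm_sub_lt_one_of_inner_ge {v m : EuclideanSpace ℝ (Fin 3)} (hm : ‖m‖ = 1) (hv0 : 0 < ‖v‖) (hv2 : ‖v‖ < Real.sqrt 2)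
    (hcov : Real.sqrt 2 / 2 * ‖v‖ ≤ ⟪v, m⟫_ℝ) : ‖v - m‖ < 1 := by
  have h1 : ‖v - m‖ ^ 2 = ‖v‖ ^ 2 - 2 * ⟪v, m⟫_ℝ + 1 := by
    rw [@norm_sub_sq_real, hm]; ring
  have h2 : ‖v - m‖ ^ 2 < 1 := by
    rw [h1]
    nlinarith [mul_pos hv0 (sub_pos.2 hv2)]
  have h3 : 0 ≤ ‖v - m‖ := norm_nonneg _
  nlinarith

/-- Two balls of a `1`-separated configuration at distance `< 1` coincide. -/
theorem eq_of_dist_lt_one (hX : ∀ p ∈ X, ∀ q ∈ X, p ≠ q → 1 ≤ dist p q) {x y : EuclideanSpace ℝ (Fin 3)}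
    (hx : x ∈ X) (hy : y ∈ X) (h : dist x y < 1) : x = y := by
  by_contra hne
  exact absurd (hX x hx y hy hne) (not_le.2 h)

/-! ### The twin (cap-type) dozen -/

/-- **THE √2-GAP, TWIN DOZEN.**  `c ∈ X` with a complete twin dozen across the unit menu normal `n₀` of the frame `F'`; then every `x ∈ X`, `x ≠ c`,
`dist x c < √2` is a member: `x = c + F' w` with `⟪F' w, n₀⟫ ≥ 0`, or `x = c + F' w − 2√(2/3)·n₀` with `⟪F' w, n₀⟫ > 0`, for a slot `w`. -/
theorem mem_capDozen_of_dist_lt_sqrt_two (hX : ∀ p ∈ X, ∀ q ∈ X, p ≠ q → 1 ≤ dist p q)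
    {F' : EuclideanSpace ℝ (Fin 3) ≃ₗᵢ[ℝ] EuclideanSpace ℝ (Fin 3)} {c n₀ : EuclideanSpace ℝ (Fin 3)} (hn : ‖n₀‖ = 1)
    (hmenu : ∀ w ∈ fccSlots, ⟪F' w, n₀⟫_ℝ = 0 ∨ ⟪F' w, n₀⟫_ℝ = Real.sqrt (2 / 3) ∨ ⟪F' w, n₀⟫_ℝ = -Real.sqrt (2 / 3))
    (hocc : ∀ w ∈ fccSlots, 0 ≤ ⟪F' w, n₀⟫_ℝ → c + F' w ∈ X)
    (hlow : ∀ w ∈ fccSlots, 0 < ⟪F' w, n₀⟫_ℝ → c + F' w - (2 * Real.sqrt (2 / 3)) • n₀ ∈ X)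
    {x : EuclideanSpace ℝ (Fin 3)} (hx : x ∈ X) (hxc : x ≠ c) (hd : dist x c < Real.sqrt 2) :
    ∃ w ∈ fccSlots, 0 ≤ ⟪F' w, n₀⟫_ℝ ∧ (x = c + F' w ∨ (0 < ⟪F' w, n₀⟫_ℝ ∧ x = c + F' w - (2 * Real.sqrt (2 / 3)) • n₀)) := by
  set v := x - c with hv
  have hv0 : 0 < ‖v‖ := by rw [hv, norm_pos_iff, sub_ne_zero]; exact hxc
  have hv2 : ‖v‖ < Real.sqrt 2 := by rwa [hv, ← dist_eq_norm]
  -- model data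
  set μ := F'.symm n₀ with hμ
  have hμn : ‖μ‖ = 1 := by rw [hμ, LinearIsometryEquiv.norm_map, hn]
  have hμmenu : ∀ w ∈ fccSlots, ⟪w, μ⟫_ℝ = 0 ∨ ⟪w, μ⟫_ℝ = Real.sqrt (2 / 3) ∨ ⟪w, μ⟫_ℝ = -Real.sqrt (2 / 3) := by
    intro w hw
    have : ⟪w, μ⟫_ℝ = ⟪F' w, n₀⟫_ℝ := by rw [hμ, ← LinearIsometryEquiv.inner_map_map F', LinearIsometryEquiv.apply_symm_apply]
    rw [this]; exact hmenu w hw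
  -- the unit direction and its reflection across the twin plane
  set v₁ := (‖v‖)⁻¹ • v with hv₁
  have hv₁n : ‖v₁‖ = 1 := by rw [hv₁, norm_smul, norm_inv, norm_norm, inv_mul_cancel₀ hv0.ne']
  have hvv₁ : v = ‖v‖ • v₁ := by rw [hv₁, smul_smul, mul_inv_cancel₀ hv0.ne', one_smul]
  -- a dozen member `m ∈ X - c` with `⟪v₁, m⟫ ≥ √2/2`
  have key : ∃ w ∈ fccSlots, 0 ≤ ⟪F' w, n₀⟫_ℝ ∧ ∃ m : EuclideanSpace ℝ (Fin 3), ‖m‖ = 1 ∧ Real.sqrt 2 / 2 ≤ ⟪v₁, m⟫_ℝ ∧ c + m ∈ X ∧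
      (m = F' w ∨ (0 < ⟪F' w, n₀⟫_ℝ ∧ m = F' w - (2 * Real.sqrt (2 / 3)) • n₀)) := by
    rcases le_or_gt 0 ⟪v₁, n₀⟫_ℝ with hside | hside
    · -- `v` on the non-negative side: a non-negative slot
      have h1 : ‖F'.symm v₁‖ = 1 := by rw [LinearIsometryEquiv.norm_map, hv₁n]
      have h2 : 0 ≤ ⟪F'.symm v₁, μ⟫_ℝ := by
        rw [hμ, LinearIsometryEquiv.inner_map_map]; exact hside
      obtain ⟨s, hs, hsμ, hcov⟩ := exists_slot_cover_nonneg h1 hμn hμmenu h2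
      have hsn : 0 ≤ ⟪F' s, n₀⟫_ℝ := by
        rw [hμ, ← LinearIsometryEquiv.inner_map_map F', LinearIsometryEquiv.apply_symm_apply] at hsμ; exact hsμ
      refine ⟨s, hs, hsn, F' s, by rw [LinearIsometryEquiv.norm_map, norm_eq_one_of_mem_fccSlots hs], ?_, hocc s hs hsn, Or.inl rfl⟩
      rw [← LinearIsometryEquiv.inner_map_map F', LinearIsometryEquiv.apply_symm_apply] at hcov; exact hcov
    · -- `v` on the negative side: reflect across the twin plane
      set R := (ℝ ∙ n₀)ᗮ.reflection with hR
      have hRR : ∀ y, R (R y) = y := fun y => Submodule.reflection_reflection _ y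
      have hRsym : ∀ y z, ⟪y, R z⟫_ℝ = ⟪R y, z⟫_ℝ := fun y z => by
        rw [← LinearIsometryEquiv.inner_map_map R (R y) z, hRR]
      have hRapply : ∀ y, R y = y - (2 * ⟪y, n₀⟫_ℝ) • n₀ := fun y => reflection_unit_apply hn y
      have hnn : ⟪n₀, n₀⟫_ℝ = 1 := by rw [real_inner_self_eq_norm_sq, hn, one_pow]
      set v₂ := R v₁ with hv₂
      have hv₂n : ‖v₂‖ = 1 := by rw [hv₂, LinearIsometryEquiv.norm_map, hv₁n]
      have hv₂n₀ : ⟪v₂, n₀⟫_ℝ = -⟪v₁, n₀⟫_ℝ := by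
        rw [hv₂, hRapply]
        simp only [inner_sub_left, real_inner_smul_left, hnn]
        ring
      have h1 : ‖F'.symm v₂‖ = 1 := by rw [LinearIsometryEquiv.norm_map, hv₂n]
      have h2 : 0 ≤ ⟪F'.symm v₂, μ⟫_ℝ := by
        rw [hμ, LinearIsometryEquiv.inner_map_map, hv₂n₀]; linarith
      obtain ⟨s, hs, hsμ, hcov⟩ := exists_slot_cover_nonneg h1 hμn hμmenu h2
      have hsn : 0 ≤ ⟪F' s, n₀⟫_ℝ := by
        rw [hμ, ← LinearIsometryEquiv.inner_map_map F', LinearIsometryEquiv.apply_symm_apply] at hsμ; exact hsμ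
      rw [← LinearIsometryEquiv.inner_map_map F', LinearIsometryEquiv.apply_symm_apply] at hcov
      -- the reflected slot `m = R (F' s) = F's − 2⟪F's, n₀⟫ n₀`
      set m := R (F' s) with hm
      have hFs : ‖F' s‖ = 1 := by rw [LinearIsometryEquiv.norm_map, norm_eq_one_of_mem_fccSlots hs]
      have hmn : ‖m‖ = 1 := by rw [hm, LinearIsometryEquiv.norm_map, hFs]
      have hvm : ⟪v₁, m⟫_ℝ = ⟪v₂, F' s⟫_ℝ := by rw [hm, hRsym, hv₂]
      rcases eq_or_lt_of_le hsn with h0 | hpos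
      · -- in-plane slot: `m = F' s`
        have hm0 : m = F' s := by rw [hm, hRapply, ← h0]; simp
        refine ⟨s, hs, hsn, m, hmn, by rw [hvm]; exact hcov, by rw [hm0]; exact hocc s hs hsn, Or.inl hm0⟩
      · -- positive slot: `m` is the lowered capper
        have hsh : ⟪F' s, n₀⟫_ℝ = Real.sqrt (2 / 3) := by
          rcases hmenu s hs with h | h | h
          · rw [h] at hpos; exact absurd hpos (lt_irrefl 0)
          · exact h
          · rw [h] at hpos; have : 0 < Real.sqrt (2 / 3) := Real.sqrt_pos.2 (by norm_num); linarith
        have hm1 : m = F' s - (2 * Real.sqrt (2 / 3)) • n₀ := by rw [hm, hRapply, hsh]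
        refine ⟨s, hs, hsn, m, hmn, by rw [hvm]; exact hcov, by rw [hm1, ← add_sub_assoc]; exact hlow s hs hpos, Or.inr ⟨hpos, hm1⟩⟩
  obtain ⟨w, hw, hwn, m, hmn, hcov, hmX, hmw⟩ := key
  have hcov' : Real.sqrt 2 / 2 * ‖v‖ ≤ ⟪v, m⟫_ℝ := by
    rw [hvv₁, real_inner_smul_left, norm_smul, Real.norm_eq_abs, abs_of_pos hv0, hv₁n, mul_one]
    nlinarith [hcov, hv0]
  have hclose : dist x (c + m) < 1 := by
    rw [dist_eq_norm, show x - (c + m) = v - m by rw [hv]; abel]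
    exact norm_sub_lt_one_of_inner_ge hmn hv0 hv2 hcov'
  have hxm := eq_of_dist_lt_one hX hx hmX hclose
  refine ⟨w, hw, hwn, ?_⟩
  rcases hmw with hmw | ⟨hpos, hmw⟩
  · exact Or.inl (by rw [hxm, hmw])
  · exact Or.inr ⟨hpos, by rw [hxm, hmw, add_sub_assoc]⟩

/-! ### The full (cuboctahedral) dozen -/

/-- **THE √2-GAP, FULL DOZEN.**  `c ∈ X` with `c + F'·fccSlots ⊆ X`; then every `x ∈ X`, `x ≠ c`, `dist x c < √2` is `c + F' w` for a slot `w`. -/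
theorem mem_fullDozen_of_dist_lt_sqrt_two (hX : ∀ p ∈ X, ∀ q ∈ X, p ≠ q → 1 ≤ dist p q)
    {F' : EuclideanSpace ℝ (Fin 3) ≃ₗᵢ[ℝ] EuclideanSpace ℝ (Fin 3)} {c : EuclideanSpace ℝ (Fin 3)}
    (hocc : ∀ w ∈ fccSlots, c + F' w ∈ X)
    {x : EuclideanSpace ℝ (Fin 3)} (hx : x ∈ X) (hxc : x ≠ c) (hd : dist x c < Real.sqrt 2) :
    ∃ w ∈ fccSlots, x = c + F' w := by
  set v := x - c with hv
  have hv0 : 0 < ‖v‖ := by rw [hv, norm_pos_iff, sub_ne_zero]; exact hxc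
  have hv2 : ‖v‖ < Real.sqrt 2 := by rwa [hv, ← dist_eq_norm]
  set v₁ := (‖v‖)⁻¹ • v with hv₁
  have hv₁n : ‖v₁‖ = 1 := by rw [hv₁, norm_smul, norm_inv, norm_norm, inv_mul_cancel₀ hv0.ne']
  have hvv₁ : v = ‖v‖ • v₁ := by rw [hv₁, smul_smul, mul_inv_cancel₀ hv0.ne', one_smul]
  have h1 : ‖F'.symm v₁‖ = 1 := by rw [LinearIsometryEquiv.norm_map, hv₁n]
  obtain ⟨s, hs, hcov⟩ := exists_slot_cover h1
  rw [← LinearIsometryEquiv.inner_map_map F', LinearIsometryEquiv.apply_symm_apply] at hcov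
  have hmn : ‖F' s‖ = 1 := by rw [LinearIsometryEquiv.norm_map, norm_eq_one_of_mem_fccSlots hs]
  have hcov' : Real.sqrt 2 / 2 * ‖v‖ ≤ ⟪v, F' s⟫_ℝ := by
    rw [hvv₁, real_inner_smul_left, norm_smul, Real.norm_eq_abs, abs_of_pos hv0, hv₁n, mul_one]
    nlinarith [hcov, hv0]
  have hclose : dist x (c + F' s) < 1 := by
    rw [dist_eq_norm, show x - (c + F' s) = v - F' s by rw [hv]; abel]
    exact norm_sub_lt_one_of_inner_ge hmn hv0 hv2 hcov'
  exact ⟨s, hs, eq_of_dist_lt_one hX hx (hocc s hs) hclose⟩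

/-! ### The h-dozen `hcpSlots` -/

/-- A slot with positive height has height `√(2/3)`. -/
theorem apply_two_eq_of_pos {w : EuclideanSpace ℝ (Fin 3)} (hw : w ∈ fccSlots) (h : 0 < w 2) : w 2 = Real.sqrt (2 / 3) := by
  have hc : 0 < Real.sqrt (2 / 3) := Real.sqrt_pos.2 (by norm_num)
  have hc' : 0 < Real.sqrt 2 / Real.sqrt 3 := by positivity
  rw [fccSlots, mem_image] at hw
  obtain ⟨c, hct, rfl⟩ := hw
  rw [Literature.MathematicalPhysics.StatisticalMechanics.barlowPos_apply_two] at h ⊢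
  simp only [fccSlotTriples, mem_insert, mem_singleton] at hct
  rcases hct with rfl | rfl | rfl | rfl | rfl | rfl | rfl | rfl | rfl | rfl | rfl | rfl <;> norm_num at h <;>
    first | (exfalso; linarith [hc, hc']) | norm_num

/-- **THE √2-GAP, h-DOZEN.**  `p ∈ X` with `p + F·hcpSlots ⊆ X`; then every `x ∈ X`, `x ≠ p`, `dist x p < √2` is `p + F s` for an h-slot `s`. -/
theorem mem_hcpDozen_of_dist_lt_sqrt_two (hX : ∀ p ∈ X, ∀ q ∈ X, p ≠ q → 1 ≤ dist p q)
    {F : EuclideanSpace ℝ (Fin 3) ≃ₗᵢ[ℝ] EuclideanSpace ℝ (Fin 3)} {p : EuclideanSpace ℝ (Fin 3)}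
    (hfull : ∀ s ∈ hcpSlots, p + F s ∈ X)
    {x : EuclideanSpace ℝ (Fin 3)} (hx : x ∈ X) (hxp : x ≠ p) (hd : dist x p < Real.sqrt 2) :
    ∃ s ∈ hcpSlots, x = p + F s := by
  set e₃ : EuclideanSpace ℝ (Fin 3) := EuclideanSpace.single (2 : Fin 3) (1 : ℝ) with he₃
  have he₃n : ‖e₃‖ = 1 := by rw [he₃, PiLp.norm_single, norm_one]
  have hFe : ‖F e₃‖ = 1 := by rw [LinearIsometryEquiv.norm_map, he₃n]
  have hie : ∀ w : EuclideanSpace ℝ (Fin 3), ⟪F w, F e₃⟫_ℝ = w 2 := fun w => by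
    rw [LinearIsometryEquiv.inner_map_map, he₃, EuclideanSpace.inner_single_right]; simp
  have hmenu : ∀ w ∈ fccSlots, ⟪F w, F e₃⟫_ℝ = 0 ∨ ⟪F w, F e₃⟫_ℝ = Real.sqrt (2 / 3) ∨ ⟪F w, F e₃⟫_ℝ = -Real.sqrt (2 / 3) := by
    intro w hw
    rw [hie]
    have := menu_e₃ w hw
    rw [EuclideanSpace.inner_single_right] at this
    simpa using this
  have hocc : ∀ w ∈ fccSlots, 0 ≤ ⟪F w, F e₃⟫_ℝ → p + F w ∈ X := fun w hw h0 =>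
    hfull w (mem_hcpSlots_of_upper hw (by rw [hie] at h0; exact h0))
  have hlow : ∀ w ∈ fccSlots, 0 < ⟪F w, F e₃⟫_ℝ → p + F w - (2 * Real.sqrt (2 / 3)) • F e₃ ∈ X := by
    intro w hw h0
    rw [hie] at h0
    have hw2 := apply_two_eq_of_pos hw h0
    have hmir : basalMirror w = w - (2 * Real.sqrt (2 / 3)) • e₃ := by
      ext t
      rw [basalMirror_apply_coord]
      fin_cases t <;> simp [he₃, hw2]; ring
    have : p + F w - (2 * Real.sqrt (2 / 3)) • F e₃ = p + F (basalMirror w) := by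
      rw [hmir, map_sub, map_smul]; abel
    rw [this]
    exact hfull _ (basalMirror_mem_hcpSlots_of_upper hw h0.le)
  obtain ⟨w, hw, hwn, hcase⟩ := mem_capDozen_of_dist_lt_sqrt_two hX hFe hmenu hocc hlow hx hxp hd
  rcases hcase with hxw | ⟨hpos, hxw⟩
  · exact ⟨w, mem_hcpSlots_of_upper hw (by rw [hie] at hwn; exact hwn), hxw⟩
  · rw [hie] at hpos
    have hw2 := apply_two_eq_of_pos hw hpos
    have hmir : basalMirror w = w - (2 * Real.sqrt (2 / 3)) • e₃ := by
      ext t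
      rw [basalMirror_apply_coord]
      fin_cases t <;> simp [he₃, hw2]; ring
    refine ⟨basalMirror w, basalMirror_mem_hcpSlots_of_upper hw hpos.le, ?_⟩
    rw [hxw, hmir, map_sub, map_smul]; abel

/-- **DICHOTOMY AT AN h-FULL BALL**: every other ball is at distance exactly `1` (an h-slot away) or at least `√2`. -/
theorem dist_eq_one_or_sqrt_two_le_of_hcpDozen (hX : ∀ p ∈ X, ∀ q ∈ X, p ≠ q → 1 ≤ dist p q)
    {F : EuclideanSpace ℝ (Fin 3) ≃ₗᵢ[ℝ] EuclideanSpace ℝ (Fin 3)} {p : EuclideanSpace ℝ (Fin 3)}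
    (hfull : ∀ s ∈ hcpSlots, p + F s ∈ X)
    {x : EuclideanSpace ℝ (Fin 3)} (hx : x ∈ X) (hxp : x ≠ p) :
    (∃ s ∈ hcpSlots, x = p + F s) ∨ Real.sqrt 2 ≤ dist x p := by
  rcases lt_or_ge (dist x p) (Real.sqrt 2) with h | h
  · exact Or.inl (mem_hcpDozen_of_dist_lt_sqrt_two hX hfull hx hxp h)
  · exact Or.inr h

end Summit.Ventures.Crystal3D.Theorems

end
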